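import Literature.IUT.HodgeArakelov.BadPrimeGaussianMonoidsGenuineRecordOrbitOfClassLevel

/-!
# [IUTchII] Cor 3.5 (ii) / Prop 3.1 (i) at the genuine `θ_env` data: `horbit` / `horb` / `hroots` with the class-level
# inversion binder in LIFT-TOLERANT (orbit) form (proof-only; twin of `ThetaEvaluationSettingModelOfOrbitLift`)

S. Mochizuki, *Inter-universal Teichmüller theory II*, kurims Dec-2020 manuscript (pages = kurims preprint render
IUTchII-kurims-url-5036b4059555): Prop 2.2 (ii) p. 66, Rmk 2.1.1 (i) p. 65 («the vertex labeled `0` is fixed by `ι_X`»),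
Cor 2.8 (i) p. 82, Prop 3.1 (i) p. 87, Cor 3.5 (ii) p. 95 [cite: Mochizuki2012, Prop 3.1 (i) p.87]; [EtTh] (Publ. RIMS **45**
(2009), refereed; pages = PRIMS journal PDF) Prop 1.4 (ii) p. 22 («`Θ̈(Ü) = −Θ̈(Ü⁻¹)`; `Θ̈(−Ü) = −Θ̈(Ü)`»), Thm 1.6 (iii)
p. 24 («some `Π^tp_X/Π^tp_Y ≅ Z`-conjugate»), Thm 1.6 (ii) p. 24, Def 2.5 (i) p. 39, Prop 2.2 (i) p. 37, Def 2.7 p. 41. Claim key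
`Mochizuki2012` DISPUTED (D-0012). PROOF-ONLY companion (abc-iut cell, layer L6, seat abc-iut-w4-d010 gen 11; nodes
**IUTchII:Prop3.1(i)** / **IUTchII:Cor3.5(ii)**; GAP-LEDGER D-G-w4d010-2f). NO definition, NO `Prop` fact, NO instance.

WHY. abc-iut-w4-d004's file 5 of row «COR35ii-HORB-GENUINE» (`BadPrimeGaussianMonoidsGenuineRecordOrbitOfClassLevel`,
p441895 lineage) pushes the (R2)(R3) inputs of `horbit`/`horb`/`hroots` at the genuine `θ_env` data down to the three
`Δ_Θ`-CLASS-level [EtTh] Prop 1.4 statements on `η̈^Θ` — with the inversion clause in the ε-PINNED shape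
`h14iota : autMap(ι|_{Π^tp_X̲̲}, ι^Θ)(η̈^Θ|_{Π^tp_Ÿ̲̲}) = ε · η̈^Θ|_{Π^tp_Ÿ̲̲}`, which silently fixes WHICH lift of the pointed
inversion inside its `Π^tp_X`-inner class is meant (print's tangential lift, «`Θ̈(Ü⁻¹) = −Θ̈(Ü)`»; the lift «`Ü ↦ −Ü⁻¹`» fixes
`Θ̈`). Exactly as for the μ_{2l}-clause of Prop 2.2 (ii) (this seat's `ThetaEvaluationSettingModelOfOrbitLift`, p457679),
the transport that consumes it — abc-iut-L2-t8's `hroot_of_coeffChange_root` — only needs the ORBIT statement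
`∃ τ₀ ∈ Π^tp_Y̲̲, … = τ₀ · (…)`. abc-iut-L2's board (CONE-L2-STATUS v3.5, row EtTh:Prop1.4(ii)) records the function-level
package behind `h14iota` as REFUTED at `(modelχ, twistedInversion, ConstCompat)` (abc-iut-w5-d125, p447891) and that
«instantiation needs a different lift (L6 consumers w4-d004/w4-d010)»; abc-iut-L2-d1 PROVED `ι_* η̈^Θ = η̈^Θ` (the `τ₀ := 1`
shape) for the lift of record (`SettingModel.transport_etaDdχ_twistedInversion`, `transport_etaDdχq`).

WHAT THIS FILE PROVES (file 5's four theorems, every other hypothesis byte-identical, `h14iota` REPLACED by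
**`h14orbit : ∃ τ₀ : Π^tp_X̲̲, τ₀ ∈ Π^tp_Y ∧ autMap(ι|, ι^Θ)(η̈^Θ|_{Π^tp_Ÿ̲̲}) = τ₀ · η̈^Θ|_{Π^tp_Ÿ̲̲}`** — «the POINTED inversion
carries the restricted étale theta class into its `Π^tp_Y̲̲`-orbit `{η̈|, ε·η̈|}`»):
`EtaleThetaDataOfSetting.rootLevel_inputs_of_classLevel_orbit`, `EtaleLevels.horbit_thetaEnvData_inversion_of_classLevel_orbit`,
`EtaleLevels.horb_toRecord_inversion_of_classLevel_orbit`, `EtaleLevels.hroots_toRecord_inversion_of_classLevel_orbit`.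
The landed ε-pinned forms are the instance `τ₀ := ε`; a lift FIXING `η̈^Θ|` is the instance `τ₀ := 1`
(`EtaleThetaDataOfSetting.h14orbit_of_h14iota` / `h14orbit_of_h14fix`, p457679).
RESIDUAL of the `horb`/`hroots` inputs of [IUTchII] Cor 3.5 (ii) / Prop 3.1 (i) at the genuine data after this file = file 5's
residual with the inversion clause in orbit form: {the [EtTh] inversion datum (any lift; `ℤ`-reversal at `γ`, `ι² = conj δ`,
`ι ≡ +1` on `Δ_Θ/l·Δ_Θ`, a deck element for the sign clause), the `Δ_Θ`-class-level [EtTh] Prop 1.4 statements on `η̈^Θ` with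
the inversion clause `h14orbit` (GAP D-G-w4d010-2f, C-R25 (iv) L2 proof row; model-witnessed in the `τ₀ := 1` shape by
abc-iut-L2-d1), `IsEtThOrigin` + a `CyclotomeTower`, bijective `c`, `μ ⊆ O`}. HONEST FRAMING: composition of landed theorems;
nothing disputed is asserted; no side is taken on [IUTchIII] Cor 3.12; typed ≠ proved ≠ endorsed.
-/

noncomputable section

namespace Literature.IUT.HodgeArakelov

open Literature.AnabelianGeometry.EtaleTheta (ContH1 ThetaSetting RootSystem cyclotome)
open Literature.AnabelianGeometry.EtaleTheta
open EtaleThetaDataOfSetting CohomologySystemOfContH1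

/-! ### §1. The root-class-level inputs (R2)(R3) from the `Δ_Θ`-class-level statements, inversion clause in ORBIT form -/

namespace EtaleThetaDataOfSetting

variable {p : ℕ} [Fact p.Prime] {D : Literature.AnabelianGeometry.EtaleTheta.ThetaSetting p}
  {E : D.EtaleThetaData} {l : ℕ} (C : E.DoubleUnderline l)
  (ι : D.PiTemp ≃ₜ* D.PiTemp) (hι : C.Huu.map ι.toMulEquiv.toMonoidHom = C.Huu) (c : ThetaSetting.ThetaCompanion ι)

/-- **(R2)(R3) at the root-class level FROM the `Δ_Θ`-class level, inversion clause in ORBIT form**: abc-iut-w4-d004's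
`rootLevel_inputs_of_classLevel` with `h14iota` replaced by `h14orbit : ∃ τ₀ ∈ Π^tp_X̲̲ ∩ Π^tp_Y,
autMap(ι|, ι^Θ)(η̈^Θ|_{Π^tp_Ÿ̲̲}) = τ₀ · η̈^Θ|_{Π^tp_Ÿ̲̲}` — from the inversion datum (any lift of the pointed inversion), a deck
element `ε` (sign clause), a `toLZ`-generator `γ`, `ι² = conj δ` on `Π^tp_{X̲̲}`, `ι ≡ +1` on `Δ_Θ/l·Δ_Θ`, and the `Δ_Θ`-class-level
[EtTh] Prop 1.4 statements on `η̈^Θ` one gets, for the chosen root class `η̲̈^Θ`: (R2) `hsign` and `hroot` (`inversionTransport`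
carries `η̲̈` to a `Π^tp_{Y̲̲}`-conjugate), (R3) `hfree`. PROOF: the landed `have`-chain with `⟨τ₀, hτ₀, h⟩` for `⟨ε, hε₁, h14iota⟩`.
[cite: MochizukiEtTh2009, Prop 1.4 (ii) p.22] -/
theorem rootLevel_inputs_of_classLevel_orbit [hN : (PiYdd C).Normal] [hYN : D.GtpYdd.Normal] (hS : D.Sec2Hyps)
    (hchar : PiYddCharacteristic C)
    (γ ε : Pi C) (hγ : C.toLZ γ = Multiplicative.ofAdd 1) (hε₁ : (ε : D.PiTemp) ∈ D.GtpY)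
    (hε₂ : (ε : D.PiTemp) ∉ D.GtpYdd)
    (δ : Pi C) (hιι : ∀ x : Pi C, ι (ι (x : D.PiTemp)) = (δ : D.PiTemp) * (x : D.PiTemp) * (δ : D.PiTemp)⁻¹)
    (hβ : ∀ a : D.GtpTheta, a ∈ D.DeltaTheta → c.thetaIso a * a⁻¹ ∈ D.lDeltaTheta l)
    (h14sign : ∃ κ₁ : ContH1 D.toTheta D.DeltaTheta D.GtpYdd, κ₁ ^ 2 = 1 ∧
      ContH1.conj D.toTheta D.DeltaTheta (ε : D.PiTemp) E.etaDd = E.etaDd * κ₁)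
    (h14orbit : ∃ τ₀ : Pi C, (τ₀ : D.PiTemp) ∈ D.GtpY ∧
      ContH1Aut.autMap (phi C) D.DeltaTheta (inversionAlpha C ι hι) c.thetaIso
        (thetaCompanion_phi C ι hι c) (thetaCompanion_mem_deltaTheta ι c)
        (symm_mem_inf_top (PiYdd C) (inversionAlpha C ι hι) (mem_PiYdd_iff_of_piYddCharacteristic C hchar _))
        (ContH1.comap D.toTheta D.DeltaTheta C.Huu.subtype continuous_subtype_val
          (map_subtype_piYdd_inf_le_GtpYdd C ⊤) E.etaDd) =
      ContH1.conj (phi C) D.DeltaTheta τ₀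
        (ContH1.comap D.toTheta D.DeltaTheta C.Huu.subtype continuous_subtype_val
          (map_subtype_piYdd_inf_le_GtpYdd C ⊤) E.etaDd))
    (h14free : ∀ k : ℤ, k ≠ 0 → ¬ IsOfFinOrder
      (ContH1.comap D.toTheta D.DeltaTheta C.Huu.subtype continuous_subtype_val
        (map_subtype_piYdd_inf_le_GtpYdd C ⊤)
        (ContH1.conj D.toTheta D.DeltaTheta ((γ : D.PiTemp) ^ k) E.etaDd * E.etaDd⁻¹))) :
    (∃ κ : ContH1 (phi C) (D.lDeltaTheta l) (PiYdd C ⊓ ⊤), κ ^ 2 = 1 ∧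
        ContH1.conj (phi C) (D.lDeltaTheta l) ε (rootLiftClass C) = rootLiftClass C * κ) ∧
      (∃ τ₀ : Pi C, (τ₀ : D.PiTemp) ∈ D.GtpY ∧
        inversionTransport C ι hι c hchar (rootLiftClass C) = ContH1.conj (phi C) (D.lDeltaTheta l) τ₀ (rootLiftClass C)) ∧
      (∀ m n : ℤ, IsOfFinAddOrder
        ((h1Top C).symm (Additive.ofMul (ContH1.conj (phi C) (D.lDeltaTheta l) (γ ^ m) (rootLiftClass C))) -
          (h1Top C).symm (Additive.ofMul (ContH1.conj (phi C) (D.lDeltaTheta l) (γ ^ n) (rootLiftClass C)))) →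
        m = n) := by
  -- the pair and its bookkeeping, under the NAMES of abc-iut-w5-d072
  have hφ := thetaCompanion_phi C ι hι c
  have hA : ∀ a : D.GtpTheta, a ∈ D.lDeltaTheta l → c.thetaIso a ∈ D.lDeltaTheta l :=
    fun a ha => (mem_lDeltaTheta_iff_thetaCompanion ι c l a).mp ha
  have hH := mem_PiYdd_iff_of_piYddCharacteristic C hchar (inversionAlpha C ι hι)
  -- (R2) hsign and (R3) hfree / hfreeK at the root-class level (abc-iut-L2-t8's transports)
  have hsign := hsign_of_etaDd_sign C hS ε hε₁ h14sign
  have hfreeK := not_isOfFinOrder_translate_of_etaDd C γ h14free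
  have hfree := hfree_of_etaDd_free C γ h14free
  -- (R2) hroot: the Δ_Θ-image of `T η̲̈` lies in the `Π^tp_Y̲̲`-orbit of the Δ_Θ-image of `η̲̈`
  have hΔ : ∃ τ₀ : Pi C, (τ₀ : D.PiTemp) ∈ D.GtpY ∧
      ContH1.coeffChange (phi C) (D.lDeltaTheta_le l) (PiYdd C ⊓ ⊤)
          (h1TopAut (phi C) (D.lDeltaTheta l) (PiYdd C) (inversionAlpha C ι hι) c.thetaIso hφ hA hH
            (rootLiftClass C)) =
        ContH1.conj (phi C) D.DeltaTheta τ₀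
          (ContH1.coeffChange (phi C) (D.lDeltaTheta_le l) (PiYdd C ⊓ ⊤) (rootLiftClass C)) := by
    obtain ⟨τ₀, hτ₀, h⟩ := h14orbit
    refine ⟨τ₀, hτ₀, ?_⟩
    rw [coeffChange_h1TopAut (phi C) (D.lDeltaTheta_le l) (PiYdd C) (inversionAlpha C ι hι) c.thetaIso hφ hA hH
        (thetaCompanion_mem_deltaTheta ι c), coeffChange_rootLiftClass_eq_comap, h1TopAut_apply]
    exact h
  have hroot := hroot_of_coeffChange_root C (inversionAlpha C ι hι) c.thetaIso hφ hA hH hS γ ε hγ hε₁ hε₂ hsign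
    hfreeK δ (inversionAlpha_apply_apply_eq_conj C ι hι δ hιι) hβ hΔ
  exact ⟨hsign, hroot, hfree⟩

end EtaleThetaDataOfSetting

/-! ### §2. `horbit` / `horb` / `hroots` at the genuine data, inversion clause in ORBIT form -/

namespace EtaleLevels

open TemperedThetaMonoids BadPrimeGaussianMonoids

variable {p : ℕ} [Fact p.Prime] {D : Literature.AnabelianGeometry.EtaleTheta.ThetaSetting p}
  {E : D.EtaleThetaData} {l : ℕ} (C : E.DoubleUnderline l) (hC : D.Compat) (hS : D.Sec2Hyps)
  (hl : l.Prime) (hp2 : p ≠ 2) (hpl : p ≠ l) (hζ : ∃ ζ : D.K, IsPrimitiveRoot ζ (4 * l))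
  (mods : ∀ M : ℕ+, D.CyclotomeMod l M)
  (f : contCocycles D.toTheta D.DeltaTheta C.GtpYdduu) (hf : f ∈ C.rootCocycles hC)
  (hmods : ∀ (M M' : ℕ+) (h : (M : ℕ) ∣ (M' : ℕ)) (x : D.lDeltaTheta l),
    MuN.red p M M' h ((mods M').red x) = (mods M).red x)
  (h15 : Literature.AnabelianGeometry.EtaleTheta.ThetaSetting.Prop15iii E hC) (L : C.CuspLabels)
  (hZ : ∀ M : ℕ+, Nonempty (ModelCyclotomes.lDeltaQuot (C.rigidData (mods M) hC hS h15 L) ≃*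
    Literature.IUT.HodgeTheaters.ZHat))
  (hcharY : EtaleThetaDataOfSetting.PiYddCharacteristic C)
  (hlim : Function.Bijective (rigidLimHom C hC hS hl hp2 hpl hζ mods f hf hmods h15 L hZ))
  [(EtaleThetaDataOfSetting.PiYdd C).Normal] [hYN : D.GtpYdd.Normal]
  (hO : D.IsEtThOrigin) {Es : Set ℕ+} (τc : D.CyclotomeTower l Es)
  -- the [EtTh] inversion datum (any lift of the pointed inversion)
  (ι : D.PiTemp ≃ₜ* D.PiTemp) (hι : C.Huu.map ι.toMulEquiv.toMonoidHom = C.Huu) (cι : ThetaSetting.ThetaCompanion ι)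
  (γ ε : Pi C) (hγ : C.toLZ γ = Multiplicative.ofAdd 1) (hε₁ : (ε : D.PiTemp) ∈ D.GtpY)
  (hε₂ : (ε : D.PiTemp) ∉ D.GtpYdd) (hZι : D.toZ (ι (γ : D.PiTemp)) = (D.toZ (γ : D.PiTemp))⁻¹)
  (δ : Pi C) (hιι : ∀ x : Pi C, ι (ι (x : D.PiTemp)) = (δ : D.PiTemp) * (x : D.PiTemp) * (δ : D.PiTemp)⁻¹)
  (hβ : ∀ a : D.GtpTheta, a ∈ D.DeltaTheta → cι.thetaIso a * a⁻¹ ∈ D.lDeltaTheta l)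
  -- the Δ_Θ-class-level [EtTh] Prop 1.4 statements on `η̈^Θ`, inversion clause in ORBIT form
  (h14sign : ∃ κ₁ : ContH1 D.toTheta D.DeltaTheta D.GtpYdd, κ₁ ^ 2 = 1 ∧
    ContH1.conj D.toTheta D.DeltaTheta (ε : D.PiTemp) E.etaDd = E.etaDd * κ₁)
  (h14free : ∀ k : ℤ, k ≠ 0 → ¬ IsOfFinOrder
    (ContH1.comap D.toTheta D.DeltaTheta C.Huu.subtype continuous_subtype_val
      (map_subtype_piYdd_inf_le_GtpYdd C ⊤)
      (ContH1.conj D.toTheta D.DeltaTheta ((γ : D.PiTemp) ^ k) E.etaDd * E.etaDd⁻¹)))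

include hO τc hγ hε₁ hε₂ hZι hιι hβ h14sign h14free

/-- **`horbit` AT THE GENUINE `θ_env` DATA from the inversion datum (any lift) and the `Δ_Θ`-class-level [EtTh] Prop 1.4
statements, inversion clause in ORBIT form** ([IUTchII] Prop 2.2 (ii) p. 66 / Prop 3.1 (i) p. 87): abc-iut-w4-d004's file 4
`horbit_thetaEnvData_inversion` with (R2)(R3) supplied by `rootLevel_inputs_of_classLevel_orbit`.
[cite: Mochizuki2012, Prop 3.1 (i) p.87] -/
theorem horbit_thetaEnvData_inversion_of_classLevel_orbit
    (h14orbit : ∃ τ₀ : Pi C, (τ₀ : D.PiTemp) ∈ D.GtpY ∧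
      ContH1Aut.autMap (phi C) D.DeltaTheta (inversionAlpha C ι hι) cι.thetaIso
        (thetaCompanion_phi C ι hι cι) (thetaCompanion_mem_deltaTheta ι cι)
        (symm_mem_inf_top (PiYdd C) (inversionAlpha C ι hι) (mem_PiYdd_iff_of_piYddCharacteristic C hcharY _))
        (ContH1.comap D.toTheta D.DeltaTheta C.Huu.subtype continuous_subtype_val
          (map_subtype_piYdd_inf_le_GtpYdd C ⊤) E.etaDd) =
      ContH1.conj (phi C) D.DeltaTheta τ₀
        (ContH1.comap D.toTheta D.DeltaTheta C.Huu.subtype continuous_subtype_val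
          (map_subtype_piYdd_inf_le_GtpYdd C ⊤) E.etaDd)) :
    ∀ x ∈ (thetaEnvData C hC hS hl hp2 hpl hζ mods f hf hmods h15 L hZ hcharY hlim).thetaIotaLim
        (pairRhoLim C (inversionAlpha C ι hι) cι.thetaIso (thetaCompanion_phi C ι hι cι)
          (mem_lDeltaTheta_iff_thetaCompanion ι cι l) (mem_PiYdd_iff_of_piYddCharacteristic C hcharY _)),
      ∀ x' ∈ (thetaEnvData C hC hS hl hp2 hpl hζ mods f hf hmods h15 L hZ hcharY hlim).thetaIotaLim
        (pairRhoLim C (inversionAlpha C ι hι) cι.thetaIso (thetaCompanion_phi C ι hι cι)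
          (mem_lDeltaTheta_iff_thetaCompanion ι cι l) (mem_PiYdd_iff_of_piYddCharacteristic C hcharY _)),
        IsOfFinAddOrder (x' - x) := by
  obtain ⟨hsign, hroot, hfree⟩ := rootLevel_inputs_of_classLevel_orbit C ι hι cι hS hcharY γ ε hγ hε₁ hε₂ δ hιι hβ
    h14sign h14orbit h14free
  exact horbit_thetaEnvData_inversion C hC hS hl hp2 hpl hζ mods f hf hmods h15 L hZ hcharY hlim hO τc ι hι cι γ ε hγ hε₁ hε₂
    hZι hsign hroot hfree

section AnyConstants

variable {Iota : Type}
  (iota : Iota → ((thetaEnvData C hC hS hl hp2 hpl hζ mods f hf hmods h15 L hZ hcharY hlim).D.coh.lim ≃+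
    (thetaEnvData C hC hS hl hp2 hpl hζ mods f hf hmods h15 L hZ hcharY hlim).D.coh.lim))
  {A : Type} [CommGroup A] [MulDistribMulAction (Pi C) A] [TopologicalSpace A] [RootableBy A ℕ]
  (c : CyclotomeCoefficients (phi C) (D.lDeltaTheta l) A)
  (hA : ∀ b : A, IsOpen (MulAction.stabilizer (Pi C) b : Set (Pi C)))
  (hfi : ∀ b : A, (MulAction.stabilizer (Pi C) b).FiniteIndex)
  (O : Submonoid A)

/-- **The Cor 3.5 (ii) junction input `horb` AT THE GENUINE RECORD from the inversion datum (any lift) and the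
`Δ_Θ`-class-level [EtTh] Prop 1.4 statements, inversion clause in ORBIT form** ([IUTchII] Cor 2.8 (i) p. 82 / Prop 3.1 (i)
p. 87): `θ^{i₀}_env(𝕄_*)` is ONE `M^×_TM`-orbit for ANY inversion family with `iota i₀ =` the limit action of `ι` — abc-iut-w4-d004's
`horb_toRecord_inversion_of_classLevel` with `h14iota` replaced by `h14orbit`. [cite: Mochizuki2012, Cor 2.8 (i) p.82] -/
theorem horb_toRecord_inversion_of_classLevel_orbit (hc : Function.Bijective c.hom)
    (hOtors : ∀ a : A, IsOfFinOrder a → a ∈ O ∧ a⁻¹ ∈ O) {i₀ : Iota}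
    (hi₀ : iota i₀ = pairRhoLim C (inversionAlpha C ι hι) cι.thetaIso (thetaCompanion_phi C ι hι cι)
      (mem_lDeltaTheta_iff_thetaCompanion ι cι l) (mem_PiYdd_iff_of_piYddCharacteristic C hcharY _))
    {θ : ((thetaEnvData C hC hS hl hp2 hpl hζ mods f hf hmods h15 L hZ hcharY hlim).toRecord
          (h1LimConjMulAut (phi C) (D.lDeltaTheta l) (PiYdd C))
          (h1LimKummerOn (phi C) (D.lDeltaTheta l) (PiYdd C) c hA hfi O) iota).H}
    (hθ : θ ∈ ((thetaEnvData C hC hS hl hp2 hpl hζ mods f hf hmods h15 L hZ hcharY hlim).toRecord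
          (h1LimConjMulAut (phi C) (D.lDeltaTheta l) (PiYdd C))
          (h1LimKummerOn (phi C) (D.lDeltaTheta l) (PiYdd C) c hA hfi O) iota).thetaEnv i₀)
    (h14orbit : ∃ τ₀ : Pi C, (τ₀ : D.PiTemp) ∈ D.GtpY ∧
      ContH1Aut.autMap (phi C) D.DeltaTheta (inversionAlpha C ι hι) cι.thetaIso
        (thetaCompanion_phi C ι hι cι) (thetaCompanion_mem_deltaTheta ι cι)
        (symm_mem_inf_top (PiYdd C) (inversionAlpha C ι hι) (mem_PiYdd_iff_of_piYddCharacteristic C hcharY _))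
        (ContH1.comap D.toTheta D.DeltaTheta C.Huu.subtype continuous_subtype_val
          (map_subtype_piYdd_inf_le_GtpYdd C ⊤) E.etaDd) =
      ContH1.conj (phi C) D.DeltaTheta τ₀
        (ContH1.comap D.toTheta D.DeltaTheta C.Huu.subtype continuous_subtype_val
          (map_subtype_piYdd_inf_le_GtpYdd C ⊤) E.etaDd)) :
    ∀ θ' ∈ ((thetaEnvData C hC hS hl hp2 hpl hζ mods f hf hmods h15 L hZ hcharY hlim).toRecord
          (h1LimConjMulAut (phi C) (D.lDeltaTheta l) (PiYdd C))
          (h1LimKummerOn (phi C) (D.lDeltaTheta l) (PiYdd C) c hA hfi O) iota).thetaEnv i₀,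
      ∃ u ∈ ((thetaEnvData C hC hS hl hp2 hpl hζ mods f hf hmods h15 L hZ hcharY hlim).toRecord
          (h1LimConjMulAut (phi C) (D.lDeltaTheta l) (PiYdd C))
          (h1LimKummerOn (phi C) (D.lDeltaTheta l) (PiYdd C) c hA hfi O) iota).units, θ' = u * θ := by
  obtain ⟨hsign, hroot, hfree⟩ := rootLevel_inputs_of_classLevel_orbit C ι hι cι hS hcharY γ ε hγ hε₁ hε₂ δ hιι hβ
    h14sign h14orbit h14free
  exact horb_toRecord_inversion C hC hS hl hp2 hpl hζ mods f hf hmods h15 L hZ hcharY hlim hO τc ι hι cι γ ε hγ hε₁ hε₂ hZι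
    iota c hA hfi O hc hOtors hsign hroot hfree hi₀ hθ

/-- **Print's root condition `hroots` AT THE GENUINE RECORD from the inversion datum (any lift) and the `Δ_Θ`-class-level
[EtTh] Prop 1.4 statements, inversion clause in ORBIT form** ([IUTchII] Prop 1.4 p. 27 / Cor 3.5 (ii) p. 95, `∞`-level):
every `ϑ ∈ ∞θ^{i₀}_env(𝕄_*)` has a positive power in `M^×_TM · θ^ℕ`, for ANY inversion family with `iota i₀ =` the limit action
of `ι` — abc-iut-w4-d004's `hroots_toRecord_inversion_of_classLevel` with `h14iota` replaced by `h14orbit`.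
[cite: Mochizuki2012, Cor 3.5 (ii) p.95] -/
theorem hroots_toRecord_inversion_of_classLevel_orbit (hc : Function.Bijective c.hom)
    (hOtors : ∀ a : A, IsOfFinOrder a → a ∈ O ∧ a⁻¹ ∈ O) {i₀ : Iota}
    (hi₀ : iota i₀ = pairRhoLim C (inversionAlpha C ι hι) cι.thetaIso (thetaCompanion_phi C ι hι cι)
      (mem_lDeltaTheta_iff_thetaCompanion ι cι l) (mem_PiYdd_iff_of_piYddCharacteristic C hcharY _))
    {θ : ((thetaEnvData C hC hS hl hp2 hpl hζ mods f hf hmods h15 L hZ hcharY hlim).toRecord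
          (h1LimConjMulAut (phi C) (D.lDeltaTheta l) (PiYdd C))
          (h1LimKummerOn (phi C) (D.lDeltaTheta l) (PiYdd C) c hA hfi O) iota).H}
    (hθ : θ ∈ ((thetaEnvData C hC hS hl hp2 hpl hζ mods f hf hmods h15 L hZ hcharY hlim).toRecord
          (h1LimConjMulAut (phi C) (D.lDeltaTheta l) (PiYdd C))
          (h1LimKummerOn (phi C) (D.lDeltaTheta l) (PiYdd C) c hA hfi O) iota).thetaEnv i₀)
    (h14orbit : ∃ τ₀ : Pi C, (τ₀ : D.PiTemp) ∈ D.GtpY ∧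
      ContH1Aut.autMap (phi C) D.DeltaTheta (inversionAlpha C ι hι) cι.thetaIso
        (thetaCompanion_phi C ι hι cι) (thetaCompanion_mem_deltaTheta ι cι)
        (symm_mem_inf_top (PiYdd C) (inversionAlpha C ι hι) (mem_PiYdd_iff_of_piYddCharacteristic C hcharY _))
        (ContH1.comap D.toTheta D.DeltaTheta C.Huu.subtype continuous_subtype_val
          (map_subtype_piYdd_inf_le_GtpYdd C ⊤) E.etaDd) =
      ContH1.conj (phi C) D.DeltaTheta τ₀
        (ContH1.comap D.toTheta D.DeltaTheta C.Huu.subtype continuous_subtype_val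
          (map_subtype_piYdd_inf_le_GtpYdd C ⊤) E.etaDd)) :
    ∀ ϑ ∈ ((thetaEnvData C hC hS hl hp2 hpl hζ mods f hf hmods h15 L hZ hcharY hlim).toRecord
          (h1LimConjMulAut (phi C) (D.lDeltaTheta l) (PiYdd C))
          (h1LimKummerOn (phi C) (D.lDeltaTheta l) (PiYdd C) c hA hfi O) iota).inftyThetaEnv i₀,
      ∃ N : ℕ, 0 < N ∧ ϑ ^ N ∈ splitMonoid ((thetaEnvData C hC hS hl hp2 hpl hζ mods f hf hmods h15 L hZ hcharY hlim).toRecord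
          (h1LimConjMulAut (phi C) (D.lDeltaTheta l) (PiYdd C))
          (h1LimKummerOn (phi C) (D.lDeltaTheta l) (PiYdd C) c hA hfi O) iota).units (Submonoid.powers θ) := by
  obtain ⟨hsign, hroot, hfree⟩ := rootLevel_inputs_of_classLevel_orbit C ι hι cι hS hcharY γ ε hγ hε₁ hε₂ δ hιι hβ
    h14sign h14orbit h14free
  exact hroots_toRecord_inversion C hC hS hl hp2 hpl hζ mods f hf hmods h15 L hZ hcharY hlim hO τc ι hι cι γ ε hγ hε₁ hε₂ hZι
    iota c hA hfi O hc hOtors hsign hroot hfree hi₀ hθ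

end AnyConstants

end EtaleLevels

end Literature.IUT.HodgeArakelov

end
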